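import Summits.KontsevichZagierPeriods.KontsevichZagierPeriods.Theorems.RootDecompZetaThreeFrontierThreeLayerP5

/-! # `RootDecompZetaThreeFrontierThreeLayerP6` — part 6/7 of the mechanical ≤340-line split of decomp-kz lens-1 g12 `ThreeLayer_v1.lean`
(sha256 4ebbf5d0…: §18 the diagonal-straightening move Σ / un-bending τ_v and their relations, §47 the layer ⟹ words algorithm;
`…GZLadder.stub_three_layer` of «gz_ladder» v4 on stmt-KontsevichZagierPeriods-32433 is proved in part 7).  Mathematics unchanged; part 6 continues part 5. -/

set_option linter.dupNamespace false

noncomputable section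

namespace Summit.KontsevichZagierPeriods.KontsevichZagierPeriods.Cruxes.GZNormalFormWThree.GZLadder

open Set MeasureTheory Literature.NumberTheory.Transcendental
open Summit.KontsevichZagierPeriods.RootDecompZetaThreeFrontier
open Summit.KontsevichZagierPeriods.KontsevichZagierPeriods.Theorems.RootDecompZetaThreeFrontierWordMoves (ibpQ1 ibpB1 ibpT1
  dualRep3 dualRep3_integrand mem_simplex_three_duΦ)

section ThreeLayer

/-- Auxiliary step `idFFT`: id FFT. [bookkeeping] -/
theorem idFFT (q : ℚ) {t : Fin 3 → ℝ} (ht : t ∈ KZ.openOrderedSimplex 3) :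
    WordLayer.layerF (monoP q 0 0 0) 1 1 0 1 0 t =
      (q : ℝ) * ∏ i, if (![false, false, true] : Fin 3 → Bool) i then 1 / (1 - t i) else 1 / t i := by
  obtain ⟨h0, h1, h1', h2', hd⟩ := WordLayer.simplex3_facts ht
  rw [Fin.prod_univ_three]
  simp only [WordLayer.layerF, aeval_monoP, Matrix.cons_val_zero, Matrix.cons_val_one, Matrix.cons_val_two,
    Matrix.head_cons, Matrix.tail_cons, Bool.false_eq_true, if_false, if_true, pow_zero, pow_one, mul_one]
  field_simp

/-- Auxiliary step `idFTT`: id FTT. [bookkeeping] -/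
theorem idFTT (q : ℚ) {t : Fin 3 → ℝ} (ht : t ∈ KZ.openOrderedSimplex 3) :
    WordLayer.layerF (monoP q 0 0 0) 1 0 1 1 0 t =
      (q : ℝ) * ∏ i, if (![false, true, true] : Fin 3 → Bool) i then 1 / (1 - t i) else 1 / t i := by
  obtain ⟨h0, h1, h1', h2', hd⟩ := WordLayer.simplex3_facts ht
  rw [Fin.prod_univ_three]
  simp only [WordLayer.layerF, aeval_monoP, Matrix.cons_val_zero, Matrix.cons_val_one, Matrix.cons_val_two,
    Matrix.head_cons, Matrix.tail_cons, Bool.false_eq_true, if_false, if_true, pow_zero, pow_one, mul_one]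
  field_simp

/-- Auxiliary step `idHA`: id HA. [bookkeeping] -/
theorem idHA (q : ℚ) {t : Fin 3 → ℝ} (ht : t ∈ KZ.openOrderedSimplex 3) :
    (q : ℝ) / ((1 - t 2) * t 0 * t 1) =
      (q : ℝ) * ∏ i, if (![false, false, true] : Fin 3 → Bool) i then 1 / (1 - t i) else 1 / t i := by
  obtain ⟨h0, h1, h1', h2', hd⟩ := WordLayer.simplex3_facts ht
  rw [Fin.prod_univ_three]
  simp only [Matrix.cons_val_zero, Matrix.cons_val_one, Matrix.cons_val_two, Matrix.head_cons, Matrix.tail_cons,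
    Bool.false_eq_true, if_false, if_true]
  field_simp

/-- Auxiliary step `idHB`: id HB. [bookkeeping] -/
theorem idHB (q : ℚ) {t : Fin 3 → ℝ} (ht : t ∈ KZ.openOrderedSimplex 3) :
    (q : ℝ) / ((1 - t 2) * t 1 * t 0) =
      (q : ℝ) * ∏ i, if (![false, false, true] : Fin 3 → Bool) i then 1 / (1 - t i) else 1 / t i := by
  obtain ⟨h0, h1, h1', h2', hd⟩ := WordLayer.simplex3_facts ht
  rw [Fin.prod_univ_three]
  simp only [Matrix.cons_val_zero, Matrix.cons_val_one, Matrix.cons_val_two, Matrix.head_cons, Matrix.tail_cons,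
    Bool.false_eq_true, if_false, if_true]
  field_simp

/-! ### 47b.4  the monomial clause, its transfer along identities and splits, and the expansion of a polynomial numerator -/

/-- the MONOMIAL-CLASS CLAUSE: the class `q t₀^i t₁^j t₂^k/(t₀^β₀ t₁^β₁ (1-t₁)^γ₁ (1-t₂)^γ₂ (t₀-t₂)^α)` on `Δ₃` is
congruent into `words 3 ∪ gzLETwo` -/
def WC (q : ℚ) (i j k β₀ β₁ γ₁ γ₂ α : ℕ) : Prop :=
  ∀ s : KZ.IntegralRep 3, s.domain = KZ.openOrderedSimplex 3 →
    EqOn s.integrand (WordLayer.layerF (monoP q i j k) β₀ β₁ γ₁ γ₂ α) s.domain → CongInto (words 3 ∪ gzLETwo) (KZ.of s)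

/-- Auxiliary step `wc_of_eqOn`: wc of eq On. [bookkeeping] -/
theorem wc_of_eqOn {q q' : ℚ} {i j k β₀ β₁ γ₁ γ₂ α i' j' k' a b c d e : ℕ} (h : WC q' i' j' k' a b c d e)
    (he : ∀ t ∈ KZ.openOrderedSimplex 3, WordLayer.layerF (monoP q i j k) β₀ β₁ γ₁ γ₂ α t =
      WordLayer.layerF (monoP q' i' j' k') a b c d e t) : WC q i j k β₀ β₁ γ₁ γ₂ α := fun s hd hi =>
  h s hd fun t ht => by rw [hi ht]; exact he t (by rw [← hd]; exact ht)

/-- every layer class within the layer bounds is integrable on `Δ₃` (§24) -/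
theorem lint5 {a b c d e : ℕ} {P : MvPolynomial (Fin 3) ℚ} (h : e ≤ 1 ∧ b ≤ 1 ∧ c ≤ 1 ∧ a + b + e ≤ 2 ∧ d + c + e ≤ 2) :
    IntegrableOn (WordLayer.layerF P a b c d e) (KZ.openOrderedSimplex 3) :=
  WordLayer.layer_integrableOn P h.1 h.2.1 h.2.2.1 h.2.2.2.1 h.2.2.2.2

/-- rule 1b: a class that splits pointwise into two integrable congruent classes is congruent -/
theorem wc_of_split {q : ℚ} {i j k β₀ β₁ γ₁ γ₂ α : ℕ} (q₁ : ℚ) (i₁ j₁ k₁ a₁ b₁ c₁ d₁ e₁ : ℕ) (q₂ : ℚ)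
    (i₂ j₂ k₂ a₂ b₂ c₂ d₂ e₂ : ℕ) (h₁ : WC q₁ i₁ j₁ k₁ a₁ b₁ c₁ d₁ e₁) (h₂ : WC q₂ i₂ j₂ k₂ a₂ b₂ c₂ d₂ e₂)
    (hint₁ : IntegrableOn (WordLayer.layerF (monoP q₁ i₁ j₁ k₁) a₁ b₁ c₁ d₁ e₁) (KZ.openOrderedSimplex 3))
    (hint₂ : IntegrableOn (WordLayer.layerF (monoP q₂ i₂ j₂ k₂) a₂ b₂ c₂ d₂ e₂) (KZ.openOrderedSimplex 3))
    (he : ∀ t ∈ KZ.openOrderedSimplex 3, WordLayer.layerF (monoP q i j k) β₀ β₁ γ₁ γ₂ α t =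
      WordLayer.layerF (monoP q₁ i₁ j₁ k₁) a₁ b₁ c₁ d₁ e₁ t + WordLayer.layerF (monoP q₂ i₂ j₂ k₂) a₂ b₂ c₂ d₂ e₂ t) :
    WC q i j k β₀ β₁ γ₁ γ₂ α := by
  intro s hd hi
  exact WordLayer.of_add_split3 _ s (WordLayer.repThree _ (WordLayer.layerF_sa _ a₁ b₁ c₁ d₁ e₁) hint₁)
    (WordLayer.repThree _ (WordLayer.layerF_sa _ a₂ b₂ c₂ d₂ e₂) hint₂) hd rfl rfl
    (fun z hz => by rw [hi (by rw [hd]; exact hz)]; exact he z hz)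
    (h₁ _ rfl fun z _ => rfl) (h₂ _ rfl fun z _ => rfl)

/-- a layer integrand is the sum of its monomial classes -/
theorem layerF_eq_sum (Q : MvPolynomial (Fin 3) ℚ) (β₀ β₁ γ₁ γ₂ α : ℕ) (t : Fin 3 → ℝ) :
    WordLayer.layerF Q β₀ β₁ γ₁ γ₂ α t =
      ∑ m ∈ Q.support, WordLayer.layerF (monoP (Q.coeff m) (m 0) (m 1) (m 2)) β₀ β₁ γ₁ γ₂ α t := by
  simp only [WordLayer.layerF]
  rw [← Finset.sum_div]
  congr 1
  conv_lhs => rw [Q.as_sum]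
  rw [map_sum]
  refine Finset.sum_congr rfl fun m _ => ?_
  rw [MvPolynomial.aeval_monomial, aeval_monoP, Finsupp.prod_pow, Fin.prod_univ_three, eq_ratCast]

/-- **monomial expansion** (rule 1b over the support): a layer class is congruent as soon as each of its monomial classes is -/
theorem congT_of_poly (Q : MvPolynomial (Fin 3) ℚ) (β₀ β₁ γ₁ γ₂ α : ℕ) (hα : α ≤ 1) (hβ : β₁ ≤ 1) (hγ : γ₁ ≤ 1)
    (h0 : β₀ + β₁ + α ≤ 2) (h1 : γ₂ + γ₁ + α ≤ 2)
    (hmono : ∀ m ∈ Q.support, WC (Q.coeff m) (m 0) (m 1) (m 2) β₀ β₁ γ₁ γ₂ α) :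
    ∀ s : KZ.IntegralRep 3, s.domain = KZ.openOrderedSimplex 3 →
      EqOn s.integrand (WordLayer.layerF Q β₀ β₁ γ₁ γ₂ α) s.domain → CongInto (words 3 ∪ gzLETwo) (KZ.of s) := by
  intro s hd hi
  have key := (WordLayer.sum_pack3 (words 3 ∪ gzLETwo) Q.support
    (fun m t => WordLayer.layerF (monoP (Q.coeff m) (m 0) (m 1) (m 2)) β₀ β₁ γ₁ γ₂ α t)
    (fun m _ => WordLayer.layerF_sa _ β₀ β₁ γ₁ γ₂ α)
    (fun m _ => WordLayer.layer_integrableOn _ hα hβ hγ h0 h1)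
    (fun m hm r hr hri => hmono m hm r hr hri)).2.2
  exact key s hd fun t ht => by rw [hi ht]; exact layerF_eq_sum Q β₀ β₁ γ₁ γ₂ α t

/-! ### 47b.5  terminals -/

/-- Auxiliary step `term_T2a`: term T2a. [bookkeeping] -/
theorem term_T2a (q : ℚ) (i j k β₀ β₁ γ₁ : ℕ) : WC q i j k β₀ β₁ γ₁ 0 0 := fun s hd hi =>
  wT2 (monoP (q / (k + 1)) i j (k + 1)) β₀ β₁ γ₁ 0 0 s hd fun t ht => by
    rw [hi ht]; exact idT2a q i j k β₀ β₁ γ₁ (by rw [← hd]; exact ht)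

/-- Auxiliary step `term_T2b`: term T2b. [bookkeeping] -/
theorem term_T2b (q : ℚ) (i j β₀ β₁ γ₁ : ℕ) : WC q i j 0 β₀ β₁ γ₁ 2 0 := fun s hd hi =>
  wT2 (monoP q i j 1) β₀ β₁ γ₁ 1 0 s hd fun t ht => by
    rw [hi ht]; exact idT2b q i j β₀ β₁ γ₁ (by rw [← hd]; exact ht)

/-- Auxiliary step `term_T1`: term T1. [bookkeeping] -/
theorem term_T1 (q : ℚ) (i j k β₀ γ₂ α : ℕ) : WC q i j k β₀ 0 0 γ₂ α := fun s hd hi =>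
  wT1 (monoP (q / (j + 1)) i (j + 1) k) β₀ 0 0 γ₂ α s hd fun t ht => by
    rw [hi ht]; exact idT1 q i j k β₀ γ₂ α (by rw [← hd]; exact ht)

/-- Auxiliary step `term_T0a`: term T0a. [bookkeeping] -/
theorem term_T0a (q : ℚ) (i j k β₁ γ₁ γ₂ : ℕ) : WC q i j k 0 β₁ γ₁ γ₂ 0 := fun s hd hi =>
  congInto_of_dual _ s hd (wT2 (dmonoP (-(q / (i + 1))) (i + 1) j k) γ₂ γ₁ β₁ 0 0 (dualRep3 s hd) rfl fun t ht => by
    rw [dualRep3_integrand, hi (by rw [hd]; exact mem_simplex_three_duΦ ht), layerF_duΦ]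
    exact idT0a q i j k β₁ γ₁ γ₂ ht)

/-- Auxiliary step `term_T0b`: term T0b. [bookkeeping] -/
theorem term_T0b (q : ℚ) (j k β₁ γ₁ γ₂ : ℕ) : WC q 0 j k 2 β₁ γ₁ γ₂ 0 := fun s hd hi =>
  congInto_of_dual _ s hd (wT2 (PT0b q j k) γ₂ γ₁ β₁ 1 0 (dualRep3 s hd) rfl fun t ht => by
    rw [dualRep3_integrand, hi (by rw [hd]; exact mem_simplex_three_duΦ ht), layerF_duΦ]
    exact idT0b q j k β₁ γ₁ γ₂ ht)

/-- Auxiliary step `term_FFT`: term FFT. [bookkeeping] -/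
theorem term_FFT (q : ℚ) : WC q 0 0 0 1 1 0 1 0 := fun s hd hi =>
  congT_word ![false, false, true] q s hd fun t ht => by rw [hi ht]; exact idFFT q (by rw [← hd]; exact ht)

/-- Auxiliary step `term_FTT`: term FTT. [bookkeeping] -/
theorem term_FTT (q : ℚ) : WC q 0 0 0 1 0 1 1 0 := fun s hd hi =>
  congT_word ![false, true, true] q s hd fun t ht => by rw [hi ht]; exact idFTT q (by rw [← hd]; exact ht)

/-- **the diagonal normal form `E_n = [Δ₃, q t₂ⁿ/(t₁(t₀-t₂))]`** (Newton–Leibniz-stuck in all three variables): the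
straightening chain carries it to two t₂-engine classes (primitives `-(q/(n+1))·((t₁-t₂)/(1-t₂))^{n+1}` resp. `(t₀-t₂)`). -/
theorem term_E (q : ℚ) (n : ℕ) : WC q 0 0 n 0 1 0 0 1 := by
  intro s hd hi
  have hi' : EqOn s.integrand (fun t => (q : ℝ) * t 2 ^ n / (t 1 * (t 0 - t 2))) s.domain := fun t ht => by
    rw [hi ht]; exact idEform q n t
  obtain ⟨rA, rB, hdA, hdB, hiA, hiB, hrel⟩ := WordLayer.straighten_chain s hd
  have hA : CongInto (words 3 ∪ gzLETwo) (KZ.of rA) :=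
    wT2 (MvPolynomial.C (-(q / (n + 1))) * (MvPolynomial.X 1 - MvPolynomial.X 2) ^ (n + 1)) 1 1 0 (n + 1) 0 rA hdA
      fun t ht => by
        have ht' : t ∈ KZ.openOrderedSimplex 3 := by rw [← hdA]; exact ht
        rw [hiA t, WordLayer.unbent_E q n s hd hi' (WordLayer.swΦ_mem_cellA ht').1, WordLayer.swΦ_zero, WordLayer.swΦ_one,
          WordLayer.swΦ_two]
        exact idEA q n ht'
  have hB : CongInto (words 3 ∪ gzLETwo) (KZ.of rB) :=
    wT2 (MvPolynomial.C (-(q / (n + 1))) * (MvPolynomial.X 0 - MvPolynomial.X 2) ^ (n + 1)) 1 1 0 (n + 1) 0 rB hdB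
      fun t ht => by
        have ht' : t ∈ KZ.openOrderedSimplex 3 := by rw [← hdB]; exact ht
        rw [hiB t, WordLayer.unbent_E q n s hd hi' (WordLayer.rotΨ_mem_cellB₀ ht').1, WordLayer.rotΨ_zero, WordLayer.rotΨ_one,
          WordLayer.rotΨ_two]
        exact idEB q n ht'
  exact congInto_of_rel2 hrel hA hB

/-- **the diagonal normal form `H = [Δ₃, q/(t₁(1-t₂)(t₀-t₂))]`**: the straightening chain carries it to TWO COPIES OF THE
WORD `q/(t₀t₁(1-t₂))` (value `2q ζ(3)`). -/
theorem term_H (q : ℚ) : WC q 0 0 0 0 1 0 1 1 := by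
  intro s hd hi
  have hi' : EqOn s.integrand (fun t => (q : ℝ) / (t 1 * (1 - t 2) * (t 0 - t 2))) s.domain := fun t ht => by
    rw [hi ht]; exact idHform q t
  obtain ⟨rA, rB, hdA, hdB, hiA, hiB, hrel⟩ := WordLayer.straighten_chain s hd
  have hA : CongInto (words 3 ∪ gzLETwo) (KZ.of rA) :=
    congT_word ![false, false, true] q rA hdA fun t ht => by
      have ht' : t ∈ KZ.openOrderedSimplex 3 := by rw [← hdA]; exact ht
      rw [hiA t, WordLayer.unbent_H q s hd hi' (WordLayer.swΦ_mem_cellA ht').1, WordLayer.swΦ_zero, WordLayer.swΦ_one,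
        WordLayer.swΦ_two]
      exact idHA q ht'
  have hB : CongInto (words 3 ∪ gzLETwo) (KZ.of rB) :=
    congT_word ![false, false, true] q rB hdB fun t ht => by
      have ht' : t ∈ KZ.openOrderedSimplex 3 := by rw [← hdB]; exact ht
      rw [hiB t, WordLayer.unbent_H q s hd hi' (WordLayer.rotΨ_mem_cellB₀ ht').1, WordLayer.rotΨ_zero, WordLayer.rotΨ_one,
        WordLayer.rotΨ_two]
      exact idHB q ht'
  exact congInto_of_rel2 hrel hA hB

/-- the duality step `q/(t₀(1-t₁)(t₀-t₂)) ↦ H` -/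
theorem dStepH (q : ℚ) (h : WC q 0 0 0 0 1 0 1 1) : WC q 0 0 0 1 0 1 0 1 := fun s hd hi =>
  congInto_of_dual _ s hd (h (dualRep3 s hd) rfl fun t ht => by
    rw [dualRep3_integrand, hi (by rw [hd]; exact mem_simplex_three_duΦ ht), layerF_duΦ]
    exact idDualH q t)

/-- the duality step `q t₂^k/((1-t₁)(t₀-t₂)) ↦ q (1-t₀)^k/(t₁(t₀-t₂))`, followed by monomial expansion -/
theorem dStepG (q : ℚ) (k : ℕ) (h : ∀ (q' : ℚ) (a b c : ℕ), WC q' a b c 0 1 0 0 1) : WC q 0 0 k 0 0 1 0 1 := fun s hd hi =>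
  congInto_of_dual _ s hd (congT_of_poly (WordLayer.duP3 (monoP q 0 0 k)) 0 1 0 0 1 (by norm_num) (by norm_num) (by norm_num)
    (by norm_num) (by norm_num) (fun m _ => h _ _ _ _) (dualRep3 s hd) rfl fun t ht => by
      rw [dualRep3_integrand, hi (by rw [hd]; exact mem_simplex_three_duΦ ht), layerF_duΦ])

/-! ### 47b.6  the reduction: `α = 0` by the potential `i+j+k+β₀+β₁+γ₁`, `α = 1` by `(γ₁, 2(i+j+β₀+β₁)+k)` -/

/-- **every monomial layer class with `α = 0` is congruent into `words 3 ∪ gzLETwo`** -/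
theorem wcA : ∀ (n : ℕ) (q : ℚ) (i j k β₀ β₁ γ₁ γ₂ : ℕ), i + j + k + β₀ + β₁ + γ₁ ≤ n → β₁ ≤ 1 → γ₁ ≤ 1 →
    β₀ + β₁ ≤ 2 → γ₂ + γ₁ ≤ 2 → WC q i j k β₀ β₁ γ₁ γ₂ 0 := by
  intro n
  induction n with
  | zero =>
    intro q i j k β₀ β₁ γ₁ γ₂ hΦ _ _ _ _
    obtain rfl : i = 0 := by omega
    obtain rfl : j = 0 := by omega
    obtain rfl : k = 0 := by omega
    obtain rfl : β₀ = 0 := by omega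
    obtain rfl : β₁ = 0 := by omega
    obtain rfl : γ₁ = 0 := by omega
    exact term_T0a q 0 0 0 0 0 γ₂
  | succ n IH =>
    intro q i j k β₀ β₁ γ₁ γ₂ hΦ hb1 hg1 h0 h1
    by_cases hc0 : 1 ≤ i ∧ 1 ≤ β₀
    · obtain ⟨i', rfl⟩ : ∃ i', i = i' + 1 := ⟨i - 1, by omega⟩
      obtain ⟨b', rfl⟩ : ∃ b', β₀ = b' + 1 := ⟨β₀ - 1, by omega⟩
      exact wc_of_eqOn (IH q i' j k b' β₁ γ₁ γ₂ (by omega) hb1 hg1 (by omega) h1)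
        fun t ht => idCancel0 q i' j k b' β₁ γ₁ γ₂ 0 ht
    by_cases hc1 : 1 ≤ j ∧ 1 ≤ β₁
    · obtain ⟨j', rfl⟩ : ∃ j', j = j' + 1 := ⟨j - 1, by omega⟩
      obtain ⟨b', rfl⟩ : ∃ b', β₁ = b' + 1 := ⟨β₁ - 1, by omega⟩
      exact wc_of_eqOn (IH q i j' k β₀ b' γ₁ γ₂ (by omega) (by omega) hg1 (by omega) h1)
        fun t ht => idCancel1 q i j' k β₀ b' γ₁ γ₂ 0 ht
    rcases Nat.lt_or_ge β₀ 1 with hb0 | hb0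
    · obtain rfl : β₀ = 0 := by omega
      exact term_T0a q i j k β₁ γ₁ γ₂
    obtain rfl : i = 0 := by omega
    by_cases hb2 : β₀ = 2
    · subst hb2
      obtain rfl : β₁ = 0 := by omega
      exact term_T0b q j k 0 γ₁ γ₂
    obtain rfl : β₀ = 1 := by omega
    rcases Nat.lt_or_ge γ₂ 1 with hg0 | hg0
    · obtain rfl : γ₂ = 0 := by omega
      exact term_T2a q 0 j k 1 β₁ γ₁
    by_cases h11 : β₁ = 0 ∧ γ₁ = 0
    · obtain ⟨rfl, rfl⟩ := h11
      exact term_T1 q 0 j k 1 γ₂ 0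
    by_cases hg2 : γ₂ = 2
    · subst hg2
      obtain rfl : γ₁ = 0 := by omega
      obtain rfl : β₁ = 1 := by omega
      obtain rfl : j = 0 := by omega
      rcases k with _ | k'
      · exact term_T2b q 0 0 1 1 0
      · exact wc_of_split q 0 0 k' 1 1 0 2 0 (-q) 0 0 k' 1 1 0 1 0
          (IH q 0 0 k' 1 1 0 2 (by omega) (by omega) (by omega) (by omega) (by omega))
          (IH (-q) 0 0 k' 1 1 0 1 (by omega) (by omega) (by omega) (by omega) (by omega))
          (lint5 (by omega)) (lint5 (by omega)) fun t ht => idSplitK q 0 0 k' 1 1 0 1 0 ht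
    obtain rfl : γ₂ = 1 := by omega
    rcases k with _ | k'
    swap
    · exact wc_of_split q 0 j k' 1 β₁ γ₁ 1 0 (-q) 0 j k' 1 β₁ γ₁ 0 0
        (IH q 0 j k' 1 β₁ γ₁ 1 (by omega) hb1 hg1 (by omega) (by omega))
        (IH (-q) 0 j k' 1 β₁ γ₁ 0 (by omega) hb1 hg1 (by omega) (by omega))
        (lint5 (by omega)) (lint5 (by omega)) fun t ht => idSplitK q 0 j k' 1 β₁ γ₁ 0 0 ht
    rcases Nat.lt_or_ge γ₁ 1 with hg1' | hg1'
    · obtain rfl : γ₁ = 0 := by omega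
      obtain rfl : β₁ = 1 := by omega
      obtain rfl : j = 0 := by omega
      exact term_FFT q
    obtain rfl : γ₁ = 1 := by omega
    rcases j with _ | j'
    swap
    · obtain rfl : β₁ = 0 := by omega
      exact wc_of_split q 0 j' 0 1 0 1 1 0 (-q) 0 j' 0 1 0 0 1 0
        (IH q 0 j' 0 1 0 1 1 (by omega) (by omega) (by omega) (by omega) (by omega))
        (IH (-q) 0 j' 0 1 0 0 1 (by omega) (by omega) (by omega) (by omega) (by omega))
        (lint5 (by omega)) (lint5 (by omega)) fun t ht => idSplitJ q 0 j' 0 1 0 0 1 0 ht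
    rcases Nat.lt_or_ge β₁ 1 with hb1' | hb1'
    · obtain rfl : β₁ = 0 := by omega
      exact term_FTT q
    obtain rfl : β₁ = 1 := by omega
    exact wc_of_split q 0 0 0 1 1 0 1 0 q 0 0 0 1 0 1 1 0
      (IH q 0 0 0 1 1 0 1 (by omega) (by omega) (by omega) (by omega) (by omega))
      (IH q 0 0 0 1 0 1 1 (by omega) (by omega) (by omega) (by omega) (by omega))
      (lint5 (by omega)) (lint5 (by omega)) fun t ht => idSplitB q 0 0 0 1 0 0 1 0 ht

end ThreeLayer

end Summit.KontsevichZagierPeriods.KontsevichZagierPeriods.Cruxes.GZNormalFormWThree.GZLadder
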